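import Summits.CriticalPhenomena.SAWScalingLimit.Theorems.SAWDefectDecoherenceBoundaryClosureRInnerZigzagPolygon
import HarnessLib

/-!
# Crux `BoundaryClosureR` (stmt-CriticalPhenomena-14004), line `polygon-parity-squeeze`:
# the registered stub `stub_innerZigzagPolygonSep` (7a′) — the inner exact zigzag polygon of a
# doubly pinned Dobrushin datum, with pairwise separated corners

Landing target:
`Summits/CriticalPhenomena/SAWScalingLimit/Theorems/SAWDefectDecoherenceBoundaryClosureRInnerZigzagSep.lean`
(`--supports stmt-CriticalPhenomena-14004`).

**Statement** (`stub_innerZigzagPolygonSep`, registered verbatim).  This is the landed inner zigzag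
polygon theorem `stub_innerZigzagPolygon` (file `…InnerZigzagPolygon.lean`) strengthened by ONE
conjunct: the corners are pairwise `4r`-separated, `c ≠ c' → 4 r ≤ dist c c'`.  For a Dobrushin
domain `(Ω; pt 0, pt 1)` which is the open upper half-ball inside `B(pt 1, ρ)` and inside
`B(pt 0, r₁)`, `ρ + r₁ ≤ |pt 0 - pt 1|`, and `η > 0`, there are a Dobrushin domain `P` with the same
marked points, a finite corner set and `r > 0` such that: `P ⊆ Ω`; the `η`-deep part of `Ω` lies in
`P`; `P` is the full upper half-ball inside `B(pt 1, 7ρ/8)` and `B(pt 0, 7r₁/8)`; `∂P` off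
`B(pt 1, 15ρ/16) ∪ B(pt 0, 15r₁/16)` lies in `Ω`; `r ≤ ρ/16, r₁/16`; the corners are on `∂P`, at
distance `≥ r` from both pins and at mutual distances `≥ 4r`; every boundary point at distance `≥ r`
from the corners is a zigzag flat side point of radius `r/2`; every corner is a zigzag corner of
radius `2r`.  This is what the lattice half (7b, `stub_innerPolygonsOfZigzag`) consumes.

**Proof.**  The construction of `stub_innerZigzagPolygon` is re-run verbatim (all its building blocks
are the landed files `…InnerZigzag{Cells,Levels,Edges,Grid,Inside,Local,Setup,Assembly,Carrier,Sides,
Polygon}`): mesh `h`, corners := images under the similarity `w ↦ pt 1 + h·w` of vertices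
`triEmbed x` of the unit triangular grid, `r = h/16`.  The new conjunct is free: two distinct corners
come from distinct lattice sites, which are at Euclidean distance `≥ √3/2` in the unit grid
(`norm_triEmbed_sub_ge_of_ne`, from the hexagon-inside-circle bound `mul_triNorm_le_norm_triEmbed`),
hence at distance `≥ (√3/2) h ≥ h/4 = 4r` after scaling.

Sources: H. Duminil-Copin, S. Smirnov, Ann. of Math. 175 (2012) §3 (domains approximated by lattice
domains); folklore.  No definition and no named fact is introduced.
-/

noncomputable section

open scoped ComplexConjugate Topology
open Set Metric Filter
open Literature.Probability.LatticeModels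
open Literature.Probability.Percolation (triX triY triCell triCellStrict triX_triEmbed triY_triEmbed triDir
  mul_triNorm_le_norm_triEmbed)
open Literature.Probability.RandomPlanarGeometry
open Summit.CriticalPhenomena.SAWScalingLimit.Theorems.PolygonParitySqueeze.BoundaryWalk
open Summit.CriticalPhenomena.SAWScalingLimit.Theorems.PolygonParitySqueeze.InnerZigzag

namespace Summit.CriticalPhenomena.SAWScalingLimit.Theorems.PolygonParitySqueeze

/-- **Distinct sites of the unit triangular lattice are `≥ √3/2` apart** (in fact `≥ 1`; the weaker
bound via the graph norm `triNorm ≥ 1` and the hexagon-inside-circle estimate suffices here).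
[folklore] -/
theorem norm_triEmbed_sub_ge_of_ne {x y : Site 2} (hxy : x ≠ y) : Real.sqrt 3 / 2 ≤ ‖triEmbed x - triEmbed y‖ := by
  rw [← triEmbed_sub]
  have hne : x - y ≠ 0 := sub_ne_zero.2 hxy
  have h1 : (1 : ℤ) ≤ triNorm (x - y) := by
    rcases (triNorm_nonneg (x - y)).lt_or_eq with h | h
    · omega
    · exact absurd (eq_zero_of_triNorm_eq_zero h.symm) hne
  have h1' : (1 : ℝ) ≤ triNorm (x - y) := by exact_mod_cast h1
  have h2 := mul_triNorm_le_norm_triEmbed (x - y)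
  nlinarith [Real.sqrt_nonneg 3]

/-- **The inner exact zigzag polygon of a doubly pinned Dobrushin datum, with pairwise separated
corners** (registered stub `stub_innerZigzagPolygonSep`, 7a′, continuum half of the inner-polygon
construction (IP) of the squeeze): see the module docstring.
[cite: DuminilCopinSmirnov2012, §3 (discrete domains approximating a domain)] -/
theorem stub_innerZigzagPolygonSep : ∀ (D : DobrushinDomain) (ρ r₁ η : ℝ), 0 < ρ → 0 < r₁ → 0 < η → D.carrier ∩ Metric.ball (D.pt 1) ρ = {z : ℂ | (D.pt 1).im < z.im} ∩ Metric.ball (D.pt 1) ρ → D.carrier ∩ Metric.ball (D.pt 0) r₁ = {z : ℂ | (D.pt 0).im < z.im} ∩ Metric.ball (D.pt 0) r₁ → ρ + r₁ ≤ dist (D.pt 0) (D.pt 1) → ∃ (P : DobrushinDomain) (corners : Finset ℂ) (r : ℝ), P.pt 0 = D.pt 0 ∧ P.pt 1 = D.pt 1 ∧ P.carrier ⊆ D.carrier ∧ {z : ℂ | z ∈ D.carrier ∧ η ≤ Metric.infDist z D.carrierᶜ} ⊆ P.carrier ∧ P.carrier ∩ Metric.ball (D.pt 1) (7 * ρ /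 8) = {z : ℂ | (D.pt 1).im < z.im} ∩ Metric.ball (D.pt 1) (7 * ρ / 8) ∧ P.carrier ∩ Metric.ball (D.pt 0) (7 * r₁ / 8) = {z : ℂ | (D.pt 0).im < z.im} ∩ Metric.ball (D.pt 0) (7 * r₁ / 8) ∧ frontier P.carrier \ (Metric.ball (D.pt 1) (15 * ρ / 16) ∪ Metric.ball (D.pt 0) (15 * r₁ / 16)) ⊆ D.carrier ∧ 0 < r ∧ r ≤ ρ / 16 ∧ r ≤ r₁ / 16 ∧ (↑corners : Set ℂ) ⊆ frontier P.carrier ∧ (∀ i : Fin 2, ∀ c ∈ corners, r ≤ dist (P.pt i) c) ∧ (∀ c ∈ corners, ∀ c' ∈ corners, c ≠ c' → 4 * r ≤ dist c c') ∧ (∀ z ∈ frontier P.carrier, (∀ c ∈ corners, r ≤ dist z c) → ∃ k : Fin 6, P.carrier ∩ Metric.ball z (r / 2) = halfPlane k z ∩ Metric.ball z (r / 2)) ∧ (∀ z ∈ corners, ∃ k k' : Fin 6, P.carrier ∩ Metric.ball z (2 * r) = halfPlane k z ∩ halfPlane k' z ∩ Metric.ball z (2 * r) ∨ P.carrier ∩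 Metric.ball z (2 * r) = (halfPlane k z ∪ halfPlane k' z) ∩ Metric.ball z (2 * r)) := by
  intro D ρ r₁ η hρ hr₁ hη hflat1r hflat0r hdistr
  -- ### the datum
  have ho_fr : D.pt 1 ∈ frontier D.carrier := D.pt_mem_frontier 1
  have hp_fr : D.pt 0 ∈ frontier D.carrier := D.pt_mem_frontier 0
  have hnotin : ∀ z ∈ frontier D.carrier, z ∉ D.carrier := fun z hz hzin => by
    have : z ∈ D.carrier ∩ frontier D.carrier := ⟨hzin, hz⟩
    rw [D.isOpen.inter_frontier_eq] at this; exact this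
  have hq : ∀ (x : ℂ) (R : ℝ), 0 < R → D.carrier ∩ ball x R = {z : ℂ | x.im < z.im} ∩ ball x R →
      x + Complex.I * ((R / 2 : ℝ) : ℂ) ∈ D.carrier := by
    intro x R hR hflat
    have : x + Complex.I * ((R / 2 : ℝ) : ℂ) ∈ {z : ℂ | x.im < z.im} ∩ ball x R := by
      constructor
      · simp; linarith
      · rw [mem_ball, dist_eq_norm, add_sub_cancel_left, norm_mul, Complex.norm_I, one_mul, Complex.norm_real,
          Real.norm_of_nonneg (by linarith)]; linarith
    rw [← hflat] at this; exact this.1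
  obtain ⟨K', d', -, hK'conn, -, hd', hK'deep, hq1K, hq0K, hdeepK⟩ :=
    exists_deep_core D hη (hq _ _ hρ hflat1r) (hq _ _ hr₁ hflat0r)
  -- ### the mesh and the normalised pins
  obtain ⟨h, hh, hhε, N, hN⟩ := exists_mesh ((D.pt 0).im - (D.pt 1).im) (min (min ρ r₁) d' / 4000) (by positivity)
  have hε1 : min (min ρ r₁) d' ≤ ρ := (min_le_left _ _).trans (min_le_left _ _)
  have hε2 : min (min ρ r₁) d' ≤ r₁ := (min_le_left _ _).trans (min_le_right _ _)
  have hε3 : min (min ρ r₁) d' ≤ d' := min_le_right _ _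
  have hρh : 4000 * h ≤ ρ := by linarith
  have hr₁h : 4000 * h ≤ r₁ := by linarith
  have hρn : 4000 ≤ ρ / h := by rw [le_div_iff₀ hh]; linarith
  have hrn : 4000 ≤ r₁ / h := by rw [le_div_iff₀ hh]; linarith
  obtain ⟨p0n, X₀, a, a₀, hp0, hp0nYX, hdist, ha, ha₀, ha0, ha₀0, hflat1, hdepth1, hflat0, hdepth0, hha, hha₀⟩ :=
    normalised_pins D hh hρh hr₁h hN hflat1r hflat0r hdistr
  set o : ℂ := D.pt 1 with ho
  -- ### the face set
  obtain ⟨S, hS⟩ := exists_deepTiles D.carrier D.isBounded o hh (η₁ := 5 * h) (by positivity)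
  obtain ⟨R₁, hR₁⟩ := exists_trapezoid a a 20 0 0 ha0 ha0 (by norm_num)
  obtain ⟨R₀, hR₀⟩ := exists_trapezoid a₀ a₀ 20 X₀ N ha₀0 ha₀0 (by norm_num)
  have hK := K_noPinch hh hρh hr₁h hflat1 hflat0 hp0nYX hdist ha ha₀ hS hR₁ hR₀ hdepth1 hdepth0
  have h₀ := d0_mem_bdDarts hh hρh hr₁h hflat1 hp0nYX hdist ha ha₀ hS hR₁ hR₀
  set K := tileFaces S ∪ R₁ ∪ R₀ with hKdef
  -- ### the boundary cycle and its inside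
  obtain ⟨Per, hP0, hPd, hmin⟩ := exists_minimal_period h₀
  have hsimp := isSimpleClosedPolygon_bverts hK h₀ hP0 hPd hmin 0 one_pos
  set PD := polygonDomain (bverts K 0 1 ((0 : Site 2), (0 : Fin 6)) Per) hsimp with hPD
  obtain ⟨V, hVo, -, hPV, hunion, hfV, -⟩ :=
    PD.exists_outside Literature.Topology.PlaneTopology.JordanCurveTheorem_holds
  have hV : IsOpen V ∧ Disjoint PD.carrier V ∧ PD.carrier ∪ V = (frontier PD.carrier)ᶜ ∧ frontier V = frontier PD.carrier :=
    ⟨hVo, hPV, hunion, hfV⟩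
  obtain ⟨X₁, hX₁⟩ := exists_windowsComplement D hh hρh hr₁h hp0 ha0 ha₀0 hha hha₀ hflat1r hflat0r hdistr
  set φ := simHomeomorph o h hh.ne' with hφ
  have hφ_apply : ∀ w, φ w = o + h * w := fun w => rfl
  have hhc : (h : ℂ) ≠ 0 := Complex.ofReal_ne_zero.2 hh.ne'
  -- ### inside facts
  have hsub := carrier_subset_domain hh hρh hr₁h hflat1 hflat0 hp0nYX hdist ha ha₀ hS hR₁ hR₀ hX₁ hsimp hPd hV
  have hup := upper_one_subset_carrier hh hρh hr₁h hflat1 hflat0 hp0nYX hdist ha ha₀ hS hR₁ hR₀ hdepth1 hX₁ hsimp hPd hV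
  have hbase := anchor_inside hh hρh hr₁h hflat1 hflat0 hp0nYX hdist ha ha₀ hS hR₁ hR₀ hdepth1 hX₁ hsimp hPd hV
  have hdeep := deep_connected_subset_carrier hh hρh hr₁h hflat1 hflat0 hp0nYX hdist ha ha₀ hS hR₁ hR₀ hdepth1 hdepth0
    hX₁ hsimp hPd hV (C := φ ⁻¹' K') (φ.isConnected_preimage.2 hK'conn)
    (fun w hw => by have := hK'deep _ hw; rw [hφ_apply] at this; linarith)
    (by rw [mem_preimage, hφ_apply]; convert hq1K using 1; push_cast; field_simp)
    (by rw [mem_preimage, hφ_apply]; convert hq0K using 1; rw [← hp0]; push_cast; field_simp; ring)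
  -- ### local structure inputs
  have hin := fan_inside hsimp h₀ hPd hV hK hbase
  have hout := fan_outside hsimp h₀ hPd hV hK hbase hP0
  have hΓ := fun z (hz : z ∈ frontier PD.carrier) => exists_cells_of_mem_frontier hsimp h₀ hPd hz
  have hleft := leftFace_inside hsimp h₀ hPd hV hK hbase
  have hright := rightFace_outside hsimp h₀ hPd hV hK hbase hP0
  have hsegΓ : ∀ t : ℕ, segment ℝ (triEmbed (bwalk K (0, 0) t).1) (triEmbed ((bwalk K (0, 0) t).1 + triDir (bwalk K (0, 0) t).2)) ⊆
      frontier PD.carrier := by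
    intro t w hw
    refine (mem_frontier_iff hsimp h₀ hPd).2 ⟨t % Per, Nat.mod_lt t hP0, ?_⟩
    rw [bwalk_mod_period hPd]; exact hw
  have hcyc : ∀ u ∈ frontier PD.carrier, o + h * u ∈ D.carrier ∨ (u.im = 0 ∧ ‖u‖ ≤ a + 24) ∨
      (u.im = p0n.im ∧ ‖u - p0n‖ ≤ a₀ + 49 / 2) := by
    intro u hu
    obtain ⟨t, -, hzL, -, hL, -⟩ := hΓ u hu
    exact K_cell_cases hh hρh hr₁h hflat1 hflat0 hp0nYX ha ha₀ hS hR₁ hR₀ hL hzL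
  -- the two pinned half-balls, normalised
  have hpin1 : PD.carrier ∩ ball (0 : ℂ) (7 / 8 * (ρ / h)) = {w : ℂ | (0 : ℂ).im < w.im} ∩ ball (0 : ℂ) (7 / 8 * (ρ / h)) := by
    apply Subset.antisymm
    · rintro w ⟨hwP, hwB⟩
      refine ⟨?_, hwB⟩
      rw [mem_ball, dist_zero_right] at hwB
      rw [Complex.zero_im]
      exact (hflat1 w (by linarith)).1 (hsub hwP)
    · rintro w ⟨hwi, hwB⟩
      rw [Complex.zero_im] at hwi
      exact ⟨hup ⟨hwi, hwB⟩, hwB⟩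
  have hpin0 : PD.carrier ∩ ball p0n (7 / 8 * (r₁ / h)) = {w : ℂ | p0n.im < w.im} ∩ ball p0n (7 / 8 * (r₁ / h)) := by
    apply Subset.antisymm
    · rintro w ⟨hwP, hwB⟩
      refine ⟨?_, hwB⟩
      rw [mem_ball, dist_eq_norm] at hwB
      exact (hflat0 w (by linarith)).1 (hsub hwP)
    · rintro w ⟨hwi, hwB⟩
      exact ⟨hdeep.2 ⟨hwi, hwB⟩, hwB⟩
  -- the pins are on the cycle
  have hfr_of : ∀ c : ℂ, o + h * c ∉ D.carrier → {w : ℂ | c.im < w.im} ∩ ball c 1 ⊆ PD.carrier → c ∈ frontier PD.carrier := by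
    intro c hc hballs
    rw [frontier_eq_closure_inter_closure]
    refine ⟨Metric.mem_closure_iff.2 fun ε hε => ?_, subset_closure fun hcP => hc (hsub hcP)⟩
    refine ⟨c + Complex.I * ((min ε 1 / 2 : ℝ) : ℂ), hballs ⟨?_, ?_⟩, ?_⟩
    · simp; positivity
    · rw [mem_ball, dist_eq_norm, add_sub_cancel_left, norm_mul, Complex.norm_I, one_mul, Complex.norm_real,
        Real.norm_of_nonneg (by positivity)]
      have : min ε 1 ≤ 1 := min_le_right _ _
      linarith
    · rw [dist_comm, dist_eq_norm, add_sub_cancel_left, norm_mul, Complex.norm_I, one_mul, Complex.norm_real,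
        Real.norm_of_nonneg (by positivity)]
      have : min ε 1 ≤ ε := min_le_left _ _
      linarith
  have h0fr : (0 : ℂ) ∈ frontier PD.carrier := by
    refine hfr_of 0 (by rw [mul_zero, add_zero]; exact hnotin _ ho_fr) fun w hw => hup ⟨?_, ?_⟩
    · simpa using hw.1
    · have := hw.2; rw [mem_ball] at this ⊢; linarith
  have hp0fr : p0n ∈ frontier PD.carrier := by
    refine hfr_of p0n (by rw [hp0]; exact hnotin _ hp_fr) fun w hw => hdeep.2 ⟨hw.1, ?_⟩
    have := hw.2; rw [mem_ball] at this ⊢; linarith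
  -- ### transport and marks
  have hcar' : (PD.map φ).carrier = φ '' PD.carrier := rfl
  have hfr' : frontier (PD.map φ).carrier = φ '' frontier PD.carrier := by rw [hcar', φ.image_frontier]
  have himage : ∀ A : Set ℂ, φ '' A = (fun w => o + h * w) '' A := fun A => rfl
  have hne : D.pt 0 ≠ o := by
    intro he; rw [he, dist_self] at hdistr; linarith
  obtain ⟨Pf, hPfc, hPf0, hPf1, -⟩ := exists_dobrushinDomain_of_frontier_points (PD.map φ) (D.pt 0) o
    (by rw [hfr']; exact ⟨p0n, hp0fr, by rw [hφ_apply, hp0]⟩)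
    (by rw [hfr']; exact ⟨0, h0fr, by rw [hφ_apply, mul_zero, add_zero]⟩) hne
  rw [hcar'] at hPfc
  -- the corners
  set cornersN : Finset ℂ := ((Finset.range Per).image fun t => triEmbed ((bwalk K (0, 0) t).1 + triDir (bwalk K (0, 0) t).2)).filter
    fun c => 3 ≤ ‖c‖ ∧ 3 ≤ ‖c - p0n‖ with hcornersN
  have hIm : ∀ A B : Set ℂ, (fun w => o + h * w) '' (A ∩ B) = (fun w => o + h * w) '' A ∩ (fun w => o + h * w) '' B :=
    fun A B => (image_sim_inter_union o hh.ne' A B).1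
  have hUn : ∀ A B : Set ℂ, (fun w => o + h * w) '' (A ∪ B) = (fun w => o + h * w) '' A ∪ (fun w => o + h * w) '' B :=
    fun A B => (image_sim_inter_union o hh.ne' A B).2
  have hBall : ∀ (c : ℂ) (s : ℝ), ball (o + h * c) (h * s) = (fun w => o + h * w) '' ball c s :=
    fun c s => (image_sim_ball o hh c s).symm
  have hHp : ∀ (k : Fin 6) (c : ℂ), halfPlane k (o + h * c) = (fun w => o + h * w) '' halfPlane k c :=
    fun k c => (image_sim_halfPlane o hh k c).symm
  have hUp : ∀ c : ℂ, {z : ℂ | (o + h * c).im < z.im} = (fun w => o + h * w) '' {w : ℂ | c.im < w.im} :=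
    fun c => (image_sim_upper o hh c).symm
  have hfrI : frontier ((fun w => o + h * w) '' PD.carrier) = (fun w => o + h * w) '' frontier PD.carrier :=
    (φ.image_frontier _).symm
  have eb1 : ball o (7 * ρ / 8) = (fun w => o + h * w) '' ball 0 (7 / 8 * (ρ / h)) := by
    rw [← hBall, mul_zero, add_zero]; congr 1; field_simp
  have eu1 : {z : ℂ | o.im < z.im} = (fun w => o + h * w) '' {w : ℂ | (0 : ℂ).im < w.im} := by
    rw [← hUp, mul_zero, add_zero]
  refine ⟨Pf, cornersN.image φ, h / 16, hPf0, hPf1, ?_, ?_, ?_, ?_, ?_, by positivity, by linarith, by linarith, ?_, ?_, ?_, ?_, ?_⟩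
  · -- `P ⊆ Ω`
    rw [hPfc]; rintro _ ⟨w, hw, rfl⟩; exact hsub hw
  · -- the `η`-deep part is inside
    rw [hPfc]; intro z hz
    refine ⟨φ.symm z, hdeep.1 ?_, φ.apply_symm_apply z⟩
    show φ (φ.symm z) ∈ K'
    rw [φ.apply_symm_apply]; exact hdeepK hz
  · -- the gate half-ball
    rw [hPfc, himage, eb1, eu1, ← hIm, ← hIm, hpin1]
  · -- the root half-ball
    rw [hPfc, himage, ← hp0, show 7 * r₁ / 8 = h * (7 / 8 * (r₁ / h)) by field_simp, hBall, hUp, ← hIm, ← hIm, hpin0]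
  · -- the boundary off the pin balls is in `Ω`
    rw [hPfc, himage, hfrI]
    rintro _ ⟨⟨w, hw, rfl⟩, hnot⟩
    rcases hcyc w hw with hin' | ⟨-, hn⟩ | ⟨-, hn⟩
    · exact hin'
    · exfalso; apply hnot; left
      rw [mem_ball, dist_eq_norm, add_sub_cancel_left, norm_mul, Complex.norm_real, Real.norm_of_nonneg hh.le]
      nlinarith
    · exfalso; apply hnot; right
      rw [mem_ball, ← hp0, dist_sim o hh.le, dist_eq_norm]
      nlinarith
  · -- corners are on the boundary
    rw [hPfc, himage, hfrI, Finset.coe_image]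
    refine image_mono fun c hc => ?_
    rw [Finset.mem_coe, hcornersN, Finset.mem_filter, Finset.mem_image] at hc
    obtain ⟨⟨t, -, rfl⟩, -⟩ := hc
    exact vertex_mem_frontier hsimp hsegΓ t
  · -- corners are far from the marked points
    intro i c hc
    rw [Finset.mem_image] at hc
    obtain ⟨cN, hcN, rfl⟩ := hc
    rw [hcornersN, Finset.mem_filter] at hcN
    obtain ⟨-, h3, h3'⟩ := hcN
    fin_cases i
    · show h / 16 ≤ dist (Pf.pt 0) (φ cN)
      rw [hPf0, ← hp0, hφ_apply, dist_sim o hh.le, dist_eq_norm, ← norm_neg, neg_sub]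
      nlinarith
    · show h / 16 ≤ dist (Pf.pt 1) (φ cN)
      rw [hPf1, hφ_apply, dist_eq_norm, sub_add_cancel_left, norm_neg, norm_mul, Complex.norm_real, Real.norm_of_nonneg hh.le]
      nlinarith
  · -- corners are pairwise `4r`-separated: distinct grid vertices are `≥ (√3/2)·h` apart
    intro c hc c' hc' hne'
    rw [Finset.mem_image] at hc hc'
    obtain ⟨cN, hcN, rfl⟩ := hc
    obtain ⟨cN', hcN', rfl⟩ := hc'
    rw [hcornersN, Finset.mem_filter, Finset.mem_image] at hcN hcN'
    obtain ⟨⟨t, -, rfl⟩, -⟩ := hcN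
    obtain ⟨⟨t', -, rfl⟩, -⟩ := hcN'
    have hxy : (bwalk K (0, 0) t).1 + triDir (bwalk K (0, 0) t).2 ≠ (bwalk K (0, 0) t').1 + triDir (bwalk K (0, 0) t').2 := by
      intro e; exact hne' (by rw [e])
    have hsep := norm_triEmbed_sub_ge_of_ne hxy
    have h3 : (1 : ℝ) < Real.sqrt 3 := Real.lt_sqrt_of_sq_lt (by norm_num)
    rw [hφ_apply, hφ_apply, dist_sim o hh.le, dist_eq_norm]
    calc 4 * (h / 16) = h * (1 / 4) := by ring
      _ ≤ h * _ := mul_le_mul_of_nonneg_left (by linarith) hh.le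
  · -- flat side points
    rw [hPfc, himage, hfrI]
    rintro _ ⟨w, hw, rfl⟩ hfar
    have hfar' : ∀ t : ℕ, 3 ≤ ‖triEmbed ((bwalk K (0, 0) t).1 + triDir (bwalk K (0, 0) t).2) - 0‖ →
        3 ≤ ‖triEmbed ((bwalk K (0, 0) t).1 + triDir (bwalk K (0, 0) t).2) - p0n‖ →
        1 / 16 ≤ dist w (triEmbed ((bwalk K (0, 0) t).1 + triDir (bwalk K (0, 0) t).2)) := by
      intro t h3 h3'
      rw [sub_zero] at h3
      have hc : φ (triEmbed ((bwalk K (0, 0) t).1 + triDir (bwalk K (0, 0) t).2)) ∈ cornersN.image φ := by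
        refine Finset.mem_image_of_mem _ ?_
        rw [hcornersN, Finset.mem_filter]
        exact ⟨Finset.mem_image.2 ⟨t % Per, Finset.mem_range.2 (Nat.mod_lt t hP0), by rw [bwalk_mod_period hPd]⟩, h3, h3'⟩
      have := hfar _ hc
      rw [hφ_apply, dist_sim o hh.le] at this
      by_contra hlt
      push Not at hlt
      nlinarith
    obtain ⟨κ, hκ⟩ := flat_side_points hsimp h₀ hPd hP0 hV hK hin hout hΓ hleft hright hsegΓ (p₁ := 0) (p₀ := p0n)
      (by linarith : (4 : ℝ) ≤ 7 / 8 * (ρ / h)) (by linarith : (4 : ℝ) ≤ 7 / 8 * (r₁ / h)) hpin1 hpin0 hw hfar'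
    refine ⟨κ, ?_⟩
    rw [show h / 16 / 2 = h * (1 / 32) by ring, hBall, hHp, ← hIm, ← hIm, hκ]
  · -- corners
    intro c hc
    rw [Finset.mem_image] at hc
    obtain ⟨cN, hcN, rfl⟩ := hc
    rw [hcornersN, Finset.mem_filter, Finset.mem_image] at hcN
    obtain ⟨⟨t, -, rfl⟩, -⟩ := hcN
    obtain ⟨k, k', hkk⟩ := corner_shape hsimp h₀ hV hK hin hout hΓ t (by norm_num : (1 : ℝ) / 8 ≤ 1 / 4)
    refine ⟨k, k', ?_⟩
    rw [hPfc, himage, hφ_apply, show 2 * (h / 16) = h * (1 / 8) by ring, hBall, hHp, hHp]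
    rcases hkk with h1 | h1
    · left; rw [← hIm, ← hIm, ← hIm, h1]
    · right; rw [← hIm, ← hUn, ← hIm, h1]

end Summit.CriticalPhenomena.SAWScalingLimit.Theorems.PolygonParitySqueeze

end
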